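import Summits.ABC.ABC.Theses.IneffectiveSubspace

/-!
# Stub `stub_assembly` of line `Sketch` — crux `IneffectiveSubspace.DepthCountedABC` (stmt-ABC-14938)

THE ASSEMBLY (pure real-exponent bookkeeping). The crux `DepthCountedABC` is abc with a constant
`C(K, ε)` on the cell `ω₅(abc) ≤ K`. The three hypotheses are
* (T₀) on the 5-free cell `ω₅(abc) = 0`:  `c < C·(a·rad(bc))^{1+δ}` (member `a` at full size);
* (T_K) on the deep cells `1 ≤ ω₅(abc) ≤ K`: the same inequality;
* (P) abc with exponent `1+δ` on the cell for the triples all three of whose members are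
  power-rich at level `δ` (`rad(m)^{1+δ}·c^δ < m`).

Proof. Fix `K, ε`, put `ε' = min ε 1`, `δ = ε'/10` (so `0 < δ ≤ 1/10`, `1 + ε' = 1 + 10δ`) and take the
three constants `C₀, C₁, C₂` at level `δ`. For a triple of the cell ordered as `a ≤ b`, with
`R = rad(abc) ≥ 1` and `rad m ≤ R` for `m ∈ {a, b, c}`:
* `c` radical-like (`c ≤ rad(c)^{1+δ} c^δ`): `c^{1-δ} ≤ R^{1+δ}`;
* `b` radical-like: `c = a + b ≤ 2b`, so `c^{1-δ} ≤ 2 R^{1+δ}`;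
* `a` radical-like: by (T) `c < C (a·rad(bc))^{1+δ} ≤ C (R^{1+δ} c^δ)^{1+δ}` using
  `rad a · rad(bc) = R` (coprimality) and `rad(bc) ≤ rad(bc)^{1+δ}`, so `c^{1-δ-δ²} ≤ C R^{(1+δ)²}`;
* otherwise all three members are power-rich and (P) gives `c < C₂ R^{1+δ}` directly.
The exponent-extraction lemma `rpow_extract` (`c^t ≤ M R^κ`, `κ ≤ (1+e)t` ⟹ `c ≤ M^{1/t} R^{1+e}`)
with `e = 10δ` closes each case since `1+δ ≤ (1+10δ)(1-δ)` and `(1+δ)² ≤ (1+10δ)(1-δ-δ²)` for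
`δ ≤ 1/10`; finally `R^{1+10δ} ≤ R^{1+ε}` and the constant is `max(…) + 1`. The ordering `b < a` is the
same statement for `(b, a, c)`.

Deliberately NOT here: the other stubs of the line (`stub_LW4`, `stub_dictionary`, `stub_base`,
`stub_deepSmallFullSize`, `stub_allPowerRich`); only the implication is proved.
-/

set_option linter.dupNamespace false

namespace Summit.ABC.ABC.Theorems.DepthCountedABC

open scoped BigOperators
open Literature.NumberTheory.DiophantineGeometry (IsABCTriple rad rad_def)
open UniqueFactorizationMonoid (radical)

/-- Exponent extraction: if `c^t ≤ M·R^κ` with `t > 0`, `R ≥ 1`, `M ≥ 0` and `κ ≤ (1+e)·t`, then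
`c ≤ M^{1/t}·R^{1+e}` (raise both sides to the power `1/t` and use `R^{κ/t} ≤ R^{1+e}`). -/
theorem rpow_extract {c R M t κ e : ℝ} (hc : 0 < c) (hR : 1 ≤ R) (hM : 0 ≤ M) (ht : 0 < t)
    (hκ : κ ≤ (1 + e) * t) (h : c ^ t ≤ M * R ^ κ) : c ≤ M ^ (1 / t) * R ^ (1 + e) := by
  have hR0 : 0 ≤ R := zero_le_one.trans hR
  have h1 : (c ^ t) ^ (1 / t) = c := by
    rw [← Real.rpow_mul hc.le, mul_one_div_cancel ht.ne', Real.rpow_one]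
  have h2 : (c ^ t) ^ (1 / t) ≤ (M * R ^ κ) ^ (1 / t) :=
    Real.rpow_le_rpow (Real.rpow_nonneg hc.le _) h (by positivity)
  have h3 : (M * R ^ κ) ^ (1 / t) = M ^ (1 / t) * R ^ (κ / t) := by
    rw [Real.mul_rpow hM (Real.rpow_nonneg hR0 _), ← Real.rpow_mul hR0, mul_one_div]
  have h4 : R ^ (κ / t) ≤ R ^ (1 + e) :=
    Real.rpow_le_rpow_of_exponent_le hR (by rwa [div_le_iff₀ ht])
  calc c = (c ^ t) ^ (1 / t) := h1.symm
    _ ≤ (M * R ^ κ) ^ (1 / t) := h2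
    _ = M ^ (1 / t) * R ^ (κ / t) := h3
    _ ≤ M ^ (1 / t) * R ^ (1 + e) := mul_le_mul_of_nonneg_left h4 (Real.rpow_nonneg hM _)

/-- A radical-like LARGE member gives abc on the nose: if `c ≤ 2m`, `m ≤ r^{1+δ}·c^δ` and
`0 ≤ r ≤ R`, `R ≥ 1`, then `c ≤ 2^{1/(1-δ)}·R^{1+10δ}` (for `0 < δ ≤ 1/10`). -/
theorem large_member_bound {δ m c r R : ℝ} (hδ : 0 < δ) (hδ' : δ ≤ 1 / 10) (hc : 0 < c)
    (hr : 0 ≤ r) (hrR : r ≤ R) (hR : 1 ≤ R) (hcm : c ≤ 2 * m)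
    (hml : m ≤ r ^ (1 + δ) * c ^ δ) :
    c ≤ (2 : ℝ) ^ (1 / (1 - δ)) * R ^ (1 + 10 * δ) := by
  have hcδ : 0 < c ^ δ := Real.rpow_pos_of_pos hc δ
  have h1 : r ^ (1 + δ) ≤ R ^ (1 + δ) := Real.rpow_le_rpow hr hrR (by linarith)
  have h2 : c ≤ 2 * R ^ (1 + δ) * c ^ δ := by
    calc c ≤ 2 * m := hcm
      _ ≤ 2 * (r ^ (1 + δ) * c ^ δ) := by linarith
      _ ≤ 2 * (R ^ (1 + δ) * c ^ δ) :=
          mul_le_mul_of_nonneg_left (mul_le_mul_of_nonneg_right h1 hcδ.le) (by norm_num)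
      _ = 2 * R ^ (1 + δ) * c ^ δ := by ring
  have h3 : c ^ (1 - δ) ≤ 2 * R ^ (1 + δ) := by
    rw [Real.rpow_sub hc, Real.rpow_one, div_le_iff₀ hcδ]
    exact h2
  have hδ2 : 0 ≤ δ * (1 / 10 - δ) := mul_nonneg hδ.le (sub_nonneg.mpr hδ')
  exact rpow_extract hc hR (by norm_num) (by linarith) (by nlinarith) h3

/-- A radical-like SMALL member: if `a ≤ r_a^{1+δ}·c^δ`, `r_a·r_{bc} = R`, `r_{bc} ≥ 1`, `R ≥ 1`, and the
T-statement `c < C·(a·r_{bc})^{1+δ}` holds, then `c ≤ C^{1/(1-δ-δ²)}·R^{1+10δ}` (for `0 < δ ≤ 1/10`). -/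
theorem small_member_bound {δ a c ra rbc R C : ℝ} (hδ : 0 < δ) (hδ' : δ ≤ 1 / 10) (ha : 0 ≤ a)
    (hc : 0 < c) (hra : 0 ≤ ra) (hrbc : 1 ≤ rbc) (hprod : ra * rbc = R) (hR : 1 ≤ R)
    (hC : 0 ≤ C) (hal : a ≤ ra ^ (1 + δ) * c ^ δ) (hT : c < C * (a * rbc) ^ (1 + δ)) :
    c ≤ C ^ (1 / (1 - δ - δ ^ 2)) * R ^ (1 + 10 * δ) := by
  have hR0 : 0 ≤ R := zero_le_one.trans hR
  have hrbc0 : 0 ≤ rbc := zero_le_one.trans hrbc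
  have hcδ : 0 < c ^ δ := Real.rpow_pos_of_pos hc δ
  have h1 : rbc ≤ rbc ^ (1 + δ) := Real.self_le_rpow_of_one_le hrbc (by linarith)
  have h2 : a * rbc ≤ R ^ (1 + δ) * c ^ δ := by
    calc a * rbc ≤ ra ^ (1 + δ) * c ^ δ * rbc ^ (1 + δ) :=
          mul_le_mul hal h1 hrbc0 (by positivity)
      _ = (ra * rbc) ^ (1 + δ) * c ^ δ := by rw [Real.mul_rpow hra hrbc0]; ring
      _ = R ^ (1 + δ) * c ^ δ := by rw [hprod]
  have h3 : (a * rbc) ^ (1 + δ) ≤ R ^ ((1 + δ) * (1 + δ)) * c ^ (δ * (1 + δ)) := by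
    calc (a * rbc) ^ (1 + δ) ≤ (R ^ (1 + δ) * c ^ δ) ^ (1 + δ) :=
          Real.rpow_le_rpow (mul_nonneg ha hrbc0) h2 (by linarith)
      _ = R ^ ((1 + δ) * (1 + δ)) * c ^ (δ * (1 + δ)) := by
          rw [Real.mul_rpow (Real.rpow_nonneg hR0 _) hcδ.le, ← Real.rpow_mul hR0,
            ← Real.rpow_mul hc.le]
  have h4 : c ≤ C * R ^ ((1 + δ) * (1 + δ)) * c ^ (δ * (1 + δ)) := by
    calc c ≤ C * (a * rbc) ^ (1 + δ) := hT.le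
      _ ≤ C * (R ^ ((1 + δ) * (1 + δ)) * c ^ (δ * (1 + δ))) := mul_le_mul_of_nonneg_left h3 hC
      _ = C * R ^ ((1 + δ) * (1 + δ)) * c ^ (δ * (1 + δ)) := by ring
  have hδ2 : 0 ≤ δ * (1 / 10 - δ) := mul_nonneg hδ.le (sub_nonneg.mpr hδ')
  have hδ3 : 0 ≤ δ ^ 2 * (1 / 10 - δ) := mul_nonneg (sq_nonneg δ) (sub_nonneg.mpr hδ')
  have ht : 0 < 1 - δ - δ ^ 2 := by nlinarith
  have h5 : c ^ (1 - δ - δ ^ 2) ≤ C * R ^ ((1 + δ) * (1 + δ)) := by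
    rw [show (1 : ℝ) - δ - δ ^ 2 = 1 - δ * (1 + δ) by ring, Real.rpow_sub hc, Real.rpow_one,
      div_le_iff₀ (Real.rpow_pos_of_pos hc _)]
    exact h4
  exact rpow_extract hc hR hC ht (by nlinarith) h5

/-- abc triples are symmetric in `a, b`. -/
theorem isABCTriple_swap {a b c : ℕ} (h : IsABCTriple a b c) : IsABCTriple b a c := by
  obtain ⟨ha, hb, habc, hcop⟩ := h
  exact ⟨hb, ha, (add_comm b a).trans habc, hcop.symm⟩

/-- The T/P case analysis for an ORDERED triple `a ≤ b` of the cell `ω₅(abc) ≤ K` at level `δ`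
(`0 < δ ≤ 1/10`), given the three cell statements with constants `C₀` (5-free T), `C₁` (deep T),
`C₂` (P): `c ≤ B·rad(abc)^{1+10δ}` with `B = max (2^{1/(1-δ)}) (max ((max C₀ C₁)^{1/(1-δ-δ²)}) C₂)`. -/
theorem ordered_bound {K : ℕ} {δ C₀ C₁ C₂ : ℝ} (hδ : 0 < δ) (hδ' : δ ≤ 1 / 10)
    (hC₀ : 0 < C₀) (hC₂ : 0 < C₂)
    (hT0 : ∀ a b c : ℕ, IsABCTriple a b c →
      ((a * b * c).primeFactors.filter (fun p => 5 ≤ (a * b * c).factorization p)).card = 0 →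
      (c : ℝ) < C₀ * ((a : ℝ) * ((radical (b * c) : ℕ) : ℝ)) ^ (1 + δ))
    (hTK : ∀ a b c : ℕ, IsABCTriple a b c →
      1 ≤ ((a * b * c).primeFactors.filter (fun p => 5 ≤ (a * b * c).factorization p)).card →
      ((a * b * c).primeFactors.filter (fun p => 5 ≤ (a * b * c).factorization p)).card ≤ K →
      (c : ℝ) < C₁ * ((a : ℝ) * ((radical (b * c) : ℕ) : ℝ)) ^ (1 + δ))
    (hP : ∀ a b c : ℕ, IsABCTriple a b c →
      ((a * b * c).primeFactors.filter (fun p => 5 ≤ (a * b * c).factorization p)).card ≤ K →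
      ((radical a : ℕ) : ℝ) ^ (1 + δ) * (c : ℝ) ^ δ < (a : ℝ) →
      ((radical b : ℕ) : ℝ) ^ (1 + δ) * (c : ℝ) ^ δ < (b : ℝ) →
      ((radical c : ℕ) : ℝ) ^ (1 + δ) * (c : ℝ) ^ δ < (c : ℝ) →
      (c : ℝ) < C₂ * ((rad a b c : ℕ) : ℝ) ^ (1 + δ))
    {a b c : ℕ} (h : IsABCTriple a b c) (hab : a ≤ b)
    (hK : ((a * b * c).primeFactors.filter (fun p => 5 ≤ (a * b * c).factorization p)).card ≤ K) :
    (c : ℝ) ≤ max ((2 : ℝ) ^ (1 / (1 - δ))) (max ((max C₀ C₁) ^ (1 / (1 - δ - δ ^ 2))) C₂) *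
      ((radical (a * b * c) : ℕ) : ℝ) ^ (1 + 10 * δ) := by
  obtain ⟨ha, hb, habc, hcop⟩ := h
  have hc : 0 < c := by omega
  have habc0 : a * b * c ≠ 0 := by positivity
  have hcR : (0 : ℝ) < c := by exact_mod_cast hc
  -- the radical of the triple and the radicals of the members
  have hR1 : (1 : ℝ) ≤ ((radical (a * b * c) : ℕ) : ℝ) := by exact_mod_cast Nat.radical_pos _
  have hRpow : (0 : ℝ) < ((radical (a * b * c) : ℕ) : ℝ) ^ (1 + 10 * δ) := by positivity
  have hrad_le : ∀ m : ℕ, m ∣ a * b * c → ((radical m : ℕ) : ℝ) ≤ ((radical (a * b * c) : ℕ) : ℝ) :=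
    fun m hm => by
      exact_mod_cast Nat.le_of_dvd (Nat.radical_pos _)
        (UniqueFactorizationMonoid.radical_dvd_radical hm habc0)
  have hra := hrad_le a ((dvd_mul_right a b).mul_right c)
  have hrb := hrad_le b ((dvd_mul_left b a).mul_right c)
  have hrc := hrad_le c (dvd_mul_left c (a * b))
  -- the four case constants are bounded by `B`
  have hB1 : (2 : ℝ) ^ (1 / (1 - δ)) ≤
      max ((2 : ℝ) ^ (1 / (1 - δ))) (max ((max C₀ C₁) ^ (1 / (1 - δ - δ ^ 2))) C₂) :=
    le_max_left _ _
  have hB2 : (max C₀ C₁) ^ (1 / (1 - δ - δ ^ 2)) ≤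
      max ((2 : ℝ) ^ (1 / (1 - δ))) (max ((max C₀ C₁) ^ (1 / (1 - δ - δ ^ 2))) C₂) :=
    (le_max_left _ _).trans (le_max_right _ _)
  have hB3 : C₂ ≤ max ((2 : ℝ) ^ (1 / (1 - δ))) (max ((max C₀ C₁) ^ (1 / (1 - δ - δ ^ 2))) C₂) :=
    (le_max_right _ _).trans (le_max_right _ _)
  by_cases hcl : (c : ℝ) ≤ ((radical c : ℕ) : ℝ) ^ (1 + δ) * (c : ℝ) ^ δ
  · -- (i) `c` is radical-like: abc on the nose
    have key := large_member_bound hδ hδ' hcR (Nat.cast_nonneg _) hrc hR1 (by linarith) hcl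
    exact key.trans (mul_le_mul_of_nonneg_right hB1 hRpow.le)
  by_cases hbl : (b : ℝ) ≤ ((radical b : ℕ) : ℝ) ^ (1 + δ) * (c : ℝ) ^ δ
  · -- (ii) `b` is radical-like: `c ≤ 2b`, abc on the nose
    have hc2b : (c : ℝ) ≤ 2 * (b : ℝ) := by exact_mod_cast (show c ≤ 2 * b by omega)
    have key := large_member_bound hδ hδ' hcR (Nat.cast_nonneg _) hrb hR1 hc2b hbl
    exact key.trans (mul_le_mul_of_nonneg_right hB1 hRpow.le)
  by_cases hal : (a : ℝ) ≤ ((radical a : ℕ) : ℝ) ^ (1 + δ) * (c : ℝ) ^ δ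
  · -- (iii) the small member `a` is radical-like: the T-statement
    have hac : Nat.Coprime a c := by
      rw [← habc]
      exact Nat.coprime_self_add_right.mpr hcop
    have hrel : IsRelPrime a (b * c) := Nat.coprime_iff_isRelPrime.mp (Nat.Coprime.mul_right hcop hac)
    have hprodN : radical a * radical (b * c) = radical (a * b * c) := by
      rw [mul_assoc a b c, UniqueFactorizationMonoid.radical_mul hrel]
    have hprod : ((radical a : ℕ) : ℝ) * ((radical (b * c) : ℕ) : ℝ) =
        ((radical (a * b * c) : ℕ) : ℝ) := by
      exact_mod_cast hprodN
    have hrbc1 : (1 : ℝ) ≤ ((radical (b * c) : ℕ) : ℝ) := by exact_mod_cast Nat.radical_pos _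
    have hnn : (0 : ℝ) ≤ ((a : ℝ) * ((radical (b * c) : ℕ) : ℝ)) ^ (1 + δ) := by positivity
    have hT : (c : ℝ) < max C₀ C₁ * ((a : ℝ) * ((radical (b * c) : ℕ) : ℝ)) ^ (1 + δ) := by
      rcases Nat.eq_zero_or_pos
          ((a * b * c).primeFactors.filter (fun p => 5 ≤ (a * b * c).factorization p)).card with
        h0 | h1
      · exact (hT0 a b c ⟨ha, hb, habc, hcop⟩ h0).trans_le
          (mul_le_mul_of_nonneg_right (le_max_left _ _) hnn)
      · exact (hTK a b c ⟨ha, hb, habc, hcop⟩ h1 hK).trans_le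
          (mul_le_mul_of_nonneg_right (le_max_right _ _) hnn)
    have key := small_member_bound hδ hδ' (Nat.cast_nonneg a) hcR (Nat.cast_nonneg _) hrbc1 hprod
      hR1 (hC₀.le.trans (le_max_left _ _)) hal hT
    exact key.trans (mul_le_mul_of_nonneg_right hB2 hRpow.le)
  · -- (iv) all three members are power-rich: the P-statement
    have key := hP a b c ⟨ha, hb, habc, hcop⟩ hK (not_le.mp hal) (not_le.mp hbl) (not_le.mp hcl)
    rw [rad_def] at key
    have hmono : ((radical (a * b * c) : ℕ) : ℝ) ^ (1 + δ) ≤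
        ((radical (a * b * c) : ℕ) : ℝ) ^ (1 + 10 * δ) :=
      Real.rpow_le_rpow_of_exponent_le hR1 (by linarith)
    calc (c : ℝ) ≤ C₂ * ((radical (a * b * c) : ℕ) : ℝ) ^ (1 + δ) := key.le
      _ ≤ C₂ * ((radical (a * b * c) : ℕ) : ℝ) ^ (1 + 10 * δ) :=
          mul_le_mul_of_nonneg_left hmono hC₂.le
      _ ≤ _ := mul_le_mul_of_nonneg_right hB3 hRpow.le

/-- **Stub `stub_assembly` (line `Sketch`, crux stmt-ABC-14938).** The two T-statements (small member
at full size on the 5-free cell and on the deep cells `1 ≤ ω₅ ≤ K`) and the P-statement (abc for the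
all-power-rich triples of the cell) imply the crux `DepthCountedABC`: given `K, ε` put `δ = min ε 1 / 10`
and run the T/P case analysis `ordered_bound` (the ordering `b < a` by the symmetry `(a, b) ↦ (b, a)`),
then `rad(abc)^{1+10δ} ≤ rad(abc)^{1+ε}`. -/
theorem stub_assembly :
    (∀ δ : ℝ, 0 < δ → ∃ C : ℝ, 0 < C ∧ ∀ a b c : ℕ,
      Literature.NumberTheory.DiophantineGeometry.IsABCTriple a b c →
      ((a * b * c).primeFactors.filter (fun p => 5 ≤ (a * b * c).factorization p)).card = 0 →
      (c : ℝ) < C * ((a : ℝ) * ((UniqueFactorizationMonoid.radical (b * c) : ℕ) : ℝ)) ^ (1 + δ)) →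
    (∀ K : ℕ, ∀ δ : ℝ, 0 < δ → ∃ C : ℝ, 0 < C ∧ ∀ a b c : ℕ,
      Literature.NumberTheory.DiophantineGeometry.IsABCTriple a b c →
      1 ≤ ((a * b * c).primeFactors.filter (fun p => 5 ≤ (a * b * c).factorization p)).card →
      ((a * b * c).primeFactors.filter (fun p => 5 ≤ (a * b * c).factorization p)).card ≤ K →
      (c : ℝ) < C * ((a : ℝ) * ((UniqueFactorizationMonoid.radical (b * c) : ℕ) : ℝ)) ^ (1 + δ)) →
    (∀ K : ℕ, ∀ δ : ℝ, 0 < δ → ∃ C : ℝ, 0 < C ∧ ∀ a b c : ℕ,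
      Literature.NumberTheory.DiophantineGeometry.IsABCTriple a b c →
      ((a * b * c).primeFactors.filter (fun p => 5 ≤ (a * b * c).factorization p)).card ≤ K →
      ((UniqueFactorizationMonoid.radical a : ℕ) : ℝ) ^ (1 + δ) * (c : ℝ) ^ δ < (a : ℝ) →
      ((UniqueFactorizationMonoid.radical b : ℕ) : ℝ) ^ (1 + δ) * (c : ℝ) ^ δ < (b : ℝ) →
      ((UniqueFactorizationMonoid.radical c : ℕ) : ℝ) ^ (1 + δ) * (c : ℝ) ^ δ < (c : ℝ) →
      (c : ℝ) < C * ((Literature.NumberTheory.DiophantineGeometry.rad a b c : ℕ) : ℝ) ^ (1 + δ)) →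
    Summit.ABC.ABC.Theses.IneffectiveSubspace.DepthCountedABC := by
  intro hT0 hTK hP
  unfold Summit.ABC.ABC.Theses.IneffectiveSubspace.DepthCountedABC
  intro K ε hε
  -- the level `δ = min ε 1 / 10`
  have hε1 : 0 < min ε 1 := lt_min hε one_pos
  have hεle : min ε 1 ≤ ε := min_le_left ε 1
  have hεle' : min ε 1 ≤ 1 := min_le_right ε 1
  obtain ⟨δ, hδ, hδ', hδε⟩ : ∃ δ : ℝ, 0 < δ ∧ δ ≤ 1 / 10 ∧ 10 * δ ≤ ε :=
    ⟨min ε 1 / 10, by positivity, by linarith, by linarith⟩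
  obtain ⟨C₀, hC₀, hT0'⟩ := hT0 δ hδ
  obtain ⟨C₁, -, hTK'⟩ := hTK K δ hδ
  obtain ⟨C₂, hC₂, hP'⟩ := hP K δ hδ
  have hB : 0 < max ((2 : ℝ) ^ (1 / (1 - δ))) (max ((max C₀ C₁) ^ (1 / (1 - δ - δ ^ 2))) C₂) :=
    lt_of_lt_of_le hC₂ ((le_max_right _ _).trans (le_max_right _ _))
  refine ⟨max ((2 : ℝ) ^ (1 / (1 - δ))) (max ((max C₀ C₁) ^ (1 / (1 - δ - δ ^ 2))) C₂) + 1,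
    by linarith, fun a b c h hK => ?_⟩
  -- the T/P case analysis, for both orderings of `a, b`
  have key : (c : ℝ) ≤ max ((2 : ℝ) ^ (1 / (1 - δ))) (max ((max C₀ C₁) ^ (1 / (1 - δ - δ ^ 2))) C₂) *
      ((radical (a * b * c) : ℕ) : ℝ) ^ (1 + 10 * δ) := by
    rcases le_or_gt a b with hab | hba
    · exact ordered_bound hδ hδ' hC₀ hC₂ hT0' hTK' hP' h hab hK
    · have hK' : ((b * a * c).primeFactors.filter (fun p => 5 ≤ (b * a * c).factorization p)).card ≤ K := by
        rwa [mul_comm b a]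
      have := ordered_bound hδ hδ' hC₀ hC₂ hT0' hTK' hP' (isABCTriple_swap h) hba.le hK'
      rwa [mul_comm b a] at this
  -- `rad(abc)^{1+10δ} ≤ rad(abc)^{1+ε}` and strictness of the final constant
  have hR1 : (1 : ℝ) ≤ ((radical (a * b * c) : ℕ) : ℝ) := by exact_mod_cast Nat.radical_pos _
  have hmono : ((radical (a * b * c) : ℕ) : ℝ) ^ (1 + 10 * δ) ≤
      ((radical (a * b * c) : ℕ) : ℝ) ^ (1 + ε) :=
    Real.rpow_le_rpow_of_exponent_le hR1 (by linarith)
  have hpos : (0 : ℝ) < ((radical (a * b * c) : ℕ) : ℝ) ^ (1 + ε) := by positivity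
  rw [rad_def]
  calc (c : ℝ) ≤ max ((2 : ℝ) ^ (1 / (1 - δ))) (max ((max C₀ C₁) ^ (1 / (1 - δ - δ ^ 2))) C₂) *
        ((radical (a * b * c) : ℕ) : ℝ) ^ (1 + 10 * δ) := key
    _ ≤ max ((2 : ℝ) ^ (1 / (1 - δ))) (max ((max C₀ C₁) ^ (1 / (1 - δ - δ ^ 2))) C₂) *
        ((radical (a * b * c) : ℕ) : ℝ) ^ (1 + ε) := mul_le_mul_of_nonneg_left hmono hB.le
    _ < (max ((2 : ℝ) ^ (1 / (1 - δ))) (max ((max C₀ C₁) ^ (1 / (1 - δ - δ ^ 2))) C₂) + 1) *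
        ((radical (a * b * c) : ℕ) : ℝ) ^ (1 + ε) := by
      rw [add_mul, one_mul]
      exact lt_add_of_pos_right _ hpos

end Summit.ABC.ABC.Theorems.DepthCountedABC
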